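import Mathlib
import Summits.Ventures.PercRepro2.Harris
import Summits.Ventures.PercRepro2.BasePrime
import Summits.Ventures.PercRepro2.LocRows
import Summits.Ventures.PercRepro2.SwRow
import Summits.Ventures.PercRepro2.SwOut
import Summits.Ventures.PercRepro2.SwAllRow
import Summits.Ventures.PercRepro2.SwOutAll
import Summits.Ventures.PercRepro2.SwOutCube
import Summits.Ventures.PercRepro2.SwOutArmFlip
import Summits.Ventures.PercRepro2.SwOutArms
import Summits.Ventures.PercRepro2.SwOutArmOrbit
import Summits.Ventures.PercRepro2.SwOutArmCube
import Summits.Ventures.PercRepro2.SwOutArmThm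
import Summits.Ventures.PercRepro2.SwOutJunction
import Summits.Ventures.PercRepro2.SwOutJunctionRegion
import Summits.Ventures.PercRepro2.SwOutCoreDefs
import Summits.Ventures.PercRepro2.SwOutCoreKey
import Summits.Ventures.PercRepro2.SwOutJunctionH1Defs

/-!
# The (H1) single junction: the points with `u` outside the hull (blind cell PercRepro2, night-4
g13, 2026-08-26; proofs/NIGHT4-G13.md §4 (O))

A `Q`-configuration of a junction class with `u` outside the hull of `h` is core-free (cores are
at `h` or `u` only), so g10's arm principle applies to its orbit: the orbit of its all-red
orientation lies in the class, keeps `u` outside the hull, has the same all-red orientation at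
every point (`orbitKind_block`), and satisfies the rigid inequality (`card_orbit_le`).  This is the
kind (O) of the partition of NIGHT4-G13.md §4, packaged for `rigidOK_of_blocks`.
-/

namespace Summit.Ventures.PercRepro2

namespace LocRows

open Hull

variable {V : Type*} {E : Type*} [Fintype E] [DecidableEq E]

open scoped Classical

variable {ends : E → Sym2 V} {U : Set V} {ξ : Config E} {l h o u : V}

/-- A `Q`-configuration with `u` outside the hull of `h` is core-free. -/
theorem coreFree_of_u_notMem_hull
    (hout : ∀ x ∈ U, x ≠ h → x ≠ o → x ≠ u →
      (∃ e y, ends e = s(x, y) ∧ y ∉ U) ∨ (∀ e, x ∉ ends e))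
    {ζ : Config E} (hζ : ζ ∈ swOutSide ends l h o U ξ) (hu : u ∉ hull ends ζ h) :
    CoreFree ends ζ h := by
  intro x hxT hxTp
  rcases core_eq_h_or_u hout hζ hxT hxTp with rfl | rfl
  · rfl
  · exact absurd (Or.inl hxT) hu

/-- **Kind (O) of the partition**: the orbit of the all-red orientation of a `Q`-configuration
with `u` outside the hull contains it, consists of class configurations with `u` outside the hull
and the same all-red orientation, and satisfies the rigid inequality. -/
theorem orbitKind_block (hl : l ∉ U) (hloop : ∀ e, ends e ≠ s(h, h))
    (hout : ∀ x ∈ U, x ≠ h → x ≠ o → x ≠ u →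
      (∃ e y, ends e = s(x, y) ∧ y ∉ U) ∨ (∀ e, x ∉ ends e))
    {ζ : Config E} (hζ : ζ ∈ swOutSide ends l h o U ξ) (hu : u ∉ hull ends ζ h) :
    ζ ∈ orbit ends (allRed ends ζ h) h ∧
    (∀ ζ' ∈ orbit ends (allRed ends ζ h) h, ζ' ∈ tgtU ends l h {S : Set V | o ∈ S} →
      ζ' ∈ swOutSide ends l h o U ξ ∧ u ∉ hull ends ζ' h ∧ allRed ends ζ' h = allRed ends ζ h) ∧
    (∀ 𝓔 : Set (Set E), IsUpperSet 𝓔 →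
      ((orbit ends (allRed ends ζ h) h).filter fun ζ' =>
          ζ' ∈ tgtU ends l h {S : Set V | o ∈ S} ∧ redEdges ends ζ' h ∈ 𝓔).card ≤
        ((orbit ends (allRed ends ζ h) h).filter fun ζ' =>
          ζ' ∈ tgtU ends l h {S : Set V | o ∈ S} ∧ blueEdges ends ζ' h ∈ 𝓔).card) := by
  have hc : CoreFree ends ζ h := coreFree_of_u_notMem_hull hout hζ hu
  have hcl : ζ ∈ outClass ends U h ξ := (mem_swOutSide.1 hζ).2
  have hc₀ : CoreFree ends (allRed ends ζ h) h := coreFree_allRed hc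
  have hcl₀ : allRed ends ζ h ∈ outClass ends U h ξ := allRed_mem_outClass hcl hc
  refine ⟨?_, ?_, ?_⟩
  · obtain ⟨ω, hω⟩ := exists_orbitReal_eq hc rfl
    simp only [orbit, Finset.mem_image, Finset.mem_univ, true_and]
    exact ⟨ω, hω⟩
  · intro ζ' hζ' hQ
    simp only [orbit, Finset.mem_image, Finset.mem_univ, true_and] at hζ'
    obtain ⟨ω, rfl⟩ := hζ'
    refine ⟨mem_swOutSide.2 ⟨hQ, orbitReal_mem_outClass hc₀ hcl₀ ω⟩, ?_, ?_⟩
    · rw [hull_orbitReal hc₀, hull_allRed hc]; exact hu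
    · rw [allRed_orbitReal hc₀, allRed_idem hc]
  · intro 𝓔 h𝓔
    exact card_orbit_le hc₀ hloop hcl₀ hl h𝓔

end LocRows

end Summit.Ventures.PercRepro2
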